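import Summits.AtomisticToContinuum.Crystallization.Theorems.LayeredLawsSelectHcp.Negative.IntegerForms

/-!
# Negative knowledge for crux `LayeredLawsSelectHcp` (stmt-AtomisticToContinuum-9226), XI:
# the hex↔cubic isometry and its master formula

Part XI (`--supports stmt-AtomisticToContinuum-9226`). The explicit linear isometry `hexIso : ℝ³ →ₗᵢ ℝ³`
(`x ↦ (⟨rᵢ, x⟩)ᵢ` for the orthonormal rows `r₀ = (1,−1,0)/√2`, `r₁ = (−1,−1,2)/√6`, `r₂ = (1,1,1)/√3`,
built as `OrthonormalBasis.repr`) carrying the cubic "pattern coordinates" of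
`Literature.Geometry.DiscreteGeometry.KissingPatterns` (hexagonal plane `x+y+z=0`, normal `(1,1,1)`) to the
"layer coordinates" of `BarlowStacking` (`u = (1,0,0)`, `v = (½, √3/2, 0)`, `w = (u+v)/3`, `n = √⅔·e₃`), and the
**master formula `hexIso_smul_intVec`**: `M(c·p) = i u + j v + Λ w + K n` whenever
`c√2(p₀−p₁) = 2i+j+Λ`, `c√2(−p₀−p₁+2p₂) = 3j+Λ`, `c√2(p₀+p₁+p₂) = 2K` — so that matching a kissing pattern to
a stacking shell reduces to INTEGER relations (part XII). All `[folklore]`.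
-/

noncomputable section

namespace Summit.AtomisticToContinuum.Crystallization.Theorems.LayeredLawsSelectHcp.Negative.HexCubic

open MeasureTheory Set
open Literature.MathematicalPhysics.StatisticalMechanics Literature.Geometry.DiscreteGeometry
open Summit.AtomisticToContinuum.Crystallization.Theses.PalmUnimodularRigidity (LayeredLawsSelectHcp)
open Summit.AtomisticToContinuum.Crystallization.Theorems.ChargedEnergyGapNegative
  (eStar eStar_le bddBelow_energyPerParticle_lennardJones)
open Summit.AtomisticToContinuum.Crystallization.Theorems.LayeredLawsSelectHcp.Negative.DiracLaws
open Summit.AtomisticToContinuum.Crystallization.Theorems.LayeredLawsSelectHcp.Negative.IntegerForms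

/-- Euclidean `3`-space. [folklore] -/
local notation "E3" => EuclideanSpace ℝ (Fin 3)

/-! ## The hex↔cubic isometry (pattern coordinates → layer coordinates) -/

section HexCubic

/-- Integer rows of the isometry: `(1,−1,0)`, `(−1,−1,2)`, `(1,1,1)`. [folklore] -/
def rowInt : Fin 3 → (Fin 3 → ℤ) := ![![1, -1, 0], ![-1, -1, 2], ![1, 1, 1]]

/-- Their squared norms `2, 6, 3`. [folklore] -/
def rowNorm : Fin 3 → ℕ := ![2, 6, 3]

/-- The orthonormal rows `(1,−1,0)/√2`, `(−1,−1,2)/√6`, `(1,1,1)/√3`. [folklore] -/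
def row (l : Fin 3) : E3 := (Real.sqrt (rowNorm l : ℝ))⁻¹ • intVec (rowInt l)

/-- Inner products of integer vectors are integer dot products. [folklore] -/
theorem inner_intVec (v w : Fin 3 → ℤ) :
    inner ℝ (intVec v) (intVec w) = ((v 0 * w 0 + v 1 * w 1 + v 2 * w 2 : ℤ) : ℝ) := by
  simp [PiLp.inner_apply, Fin.sum_univ_three, intVec_apply]
  ring

/-- The rows are unit vectors. [folklore] -/
theorem norm_row (l : Fin 3) : ‖row l‖ = 1 := by
  have h : ∀ (n : ℝ), 0 < n → |Real.sqrt n|⁻¹ * Real.sqrt n = 1 := fun n hn => by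
    rw [abs_of_pos (Real.sqrt_pos.2 hn), inv_mul_cancel₀ (Real.sqrt_pos.2 hn).ne']
  fin_cases l <;> simp [row, rowInt, rowNorm, norm_smul_intVec, sqNormInt] <;>
    first
    | exact h 2 (by norm_num)
    | exact h 6 (by norm_num)
    | exact h 3 (by norm_num)

/-- The rows are pairwise orthogonal unit vectors. [folklore] -/
theorem inner_row (l l' : Fin 3) : inner ℝ (row l) (row l') = if l = l' then (1 : ℝ) else 0 := by
  by_cases hll : l = l'
  · subst hll
    rw [if_pos rfl, real_inner_self_eq_norm_sq, norm_row, one_pow]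
  · rw [if_neg hll]
    fin_cases l <;> fin_cases l' <;> first | exact absurd rfl hll |
      (simp [row, rowInt, rowNorm, inner_smul_left, inner_smul_right, inner_intVec])

/-- The rows form an orthonormal family. [folklore] -/
theorem orthonormal_row : Orthonormal ℝ row :=
  orthonormal_iff_ite.2 inner_row

/-- The orthonormal basis of `ℝ³` formed by the rows. [folklore] -/
def hexBasis : OrthonormalBasis (Fin 3) ℝ E3 :=
  (basisOfOrthonormalOfCardEqFinrank orthonormal_row (by simp)).toOrthonormalBasis
    (by rw [coe_basisOfOrthonormalOfCardEqFinrank]; exact orthonormal_row)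

/-- The basis vectors are the rows. [folklore] -/
@[simp] theorem hexBasis_apply (l : Fin 3) : hexBasis l = row l := by
  rw [hexBasis, Module.Basis.coe_toOrthonormalBasis, coe_basisOfOrthonormalOfCardEqFinrank]

/-- **The hex↔cubic isometry** `M x = (⟨row₀, x⟩, ⟨row₁, x⟩, ⟨row₂, x⟩)`: it maps the cubic
"pattern coordinates" of `KissingPatterns` (hexagonal plane `x + y + z = 0`, normal `(1,1,1)`) to the
"layer coordinates" of `BarlowStacking` (layers `⟂ e₃`, `u = (1,0,0)`). [folklore] -/
def hexIso : E3 →ₗᵢ[ℝ] E3 := hexBasis.repr.toLinearIsometry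

/-- Coordinates of `M x`. [folklore] -/
theorem hexIso_apply (x : E3) (l : Fin 3) : hexIso x l = inner ℝ (row l) x := by
  simp [hexIso, OrthonormalBasis.repr_apply_apply]

/-- `(√2)⁻¹ = √2/2` and `(√6)⁻¹ = √2·√3/6`. [folklore] -/
theorem sqrt_identities :
    (Real.sqrt 2)⁻¹ = Real.sqrt 2 / 2 ∧ (Real.sqrt 6)⁻¹ = Real.sqrt 2 * Real.sqrt 3 / 6 := by
  have s6 : Real.sqrt 6 = Real.sqrt 2 * Real.sqrt 3 := by
    rw [← Real.sqrt_mul (by norm_num : (0:ℝ) ≤ 2)]; norm_num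
  refine ⟨?_, ?_⟩
  · rw [inv_eq_one_div, ← Real.sqrt_div_self']
  · rw [inv_eq_one_div, ← Real.sqrt_div_self', s6]

/-- **The master formula**: `M (c • p)` in layer coordinates, for an integer vector `p` and any
`c`, given the three integer-type relations that identify `i, j, Λ, K` (in-layer indices, letter shift,
layer shift): `M(c • p) = i·u + j·v + Λ·w + K·(√(2/3) e₃)`. [folklore] -/
theorem hexIso_smul_intVec (c : ℝ) (p : Fin 3 → ℤ) (i j Λ K : ℝ)
    (h1 : c * Real.sqrt 2 * (p 0 - p 1) = 2 * i + j + Λ)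
    (h2 : c * Real.sqrt 2 * (-p 0 - p 1 + 2 * p 2) = 3 * j + Λ)
    (h3 : c * Real.sqrt 2 * (p 0 + p 1 + p 2) = 2 * K) :
    hexIso (c • intVec p) =
      i • triangularVec₁ 1 + j • triangularVec₂ 1 + Λ • barlowOffset 1 +
        K • layerNormal (Real.sqrt (2 / 3)) := by
  obtain ⟨e2, e6⟩ := sqrt_identities
  have s2 : Real.sqrt 2 * Real.sqrt 2 = 2 := Real.mul_self_sqrt (by norm_num)
  ext l
  rw [hexIso_apply, inner_smul_right]
  fin_cases l <;>
    simp [row, rowInt, rowNorm, inner_smul_left, inner_intVec, triangularVec₁, triangularVec₂,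
      barlowOffset, layerNormal]
  · rw [e2]; linear_combination (1 / 2 : ℝ) * h1
  · rw [e6]; linear_combination (Real.sqrt 3 / 6) * h2
  · linear_combination (Real.sqrt 2 / Real.sqrt 3 / 2) * h3 -
      (c * ((p 0 : ℝ) + p 1 + p 2) / Real.sqrt 3 / 2) * s2

end HexCubic

end Summit.AtomisticToContinuum.Crystallization.Theorems.LayeredLawsSelectHcp.Negative.HexCubic

end
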